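import Summits.HodgeConjecture.HodgeConjecture.Theorems.VHCAbelianSchemesRoadLocusEngine
import HarnessLib

/-!
# Road b02 (`VHCAbelianSchemesRoad`, D-0059) — THE LOCAL-IN-THE-FIBRE (SPAN) FORM OF THE CRUX: each fibre of the pencil may be
# served on ANOTHER pencil through it; the `closes`-shape kernel over the UNCHANGED door

research route conditional on HC_CM; not a corollary; Q11.4-sentence-2 already refuted in dim ≥ 3.
(cell line of seat ab-andre-2: research route, not a corollary; conditional on HC_CM plus one named minimal statement.)

THEOREMS + two `@[conjecture]` predicates; no named fact, no sorry; `HC_CM` occurs nowhere; nothing of the road's research content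
is claimed. Seat ab-andre-2 gen 66 (follow-up of K-ADD, director-hodge R11.3, answering this seat's own caveat on pencils whose
monodromy normalises but does not centralise the CM field — HOME INBOX «ONE CAVEAT FOR THE SPAN CHECK»). OPTIONAL material for the
tenure planner: the route, its `closes` glue, the binders of record, rev 23 and the skeleton are NOT touched; helper
`--supports stmt-HodgeConjecture-20707`.

WHY. In the additive regime (`LefAtExceptionalRegimeAtAdd`, `VHCAbelianSchemesRoadRegimeAdditive.lean`) every carried class must extend
to a GLOBAL fibrewise-Hodge class `V i p` of THE GIVEN pencil `f`; on a Weil-cell pencil whose monodromy only normalises `K` the global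
sections of `W_K` are one line, and span buys nothing there. But the kernel never needed the data to live on `f`: the door and the curve
residual run on ANY pencil `f'` of the same shape, and algebraicity of a class on a fibre `X_t ≅ X'_{t'}` transports along the
isomorphism (`mem_algebraicClasses_map_iff_of_iso`). So the crux can be asked LOCALLY IN THE FIBRE: for every fibre `X_t` of `f` there
is SOME pencil `f'` — a smooth projective family of relative dimension `n` over a smooth irreducible affine curve with quasi-projective
total space (no abelian-fibre or section clause is needed on `f'`) — with a fibre `X'_{t'} ≅ X_t`, a global class `W'` on `𝒳'`
matching `W|_{X_t}`, and finitely many `𝒪`-data on `f'` whose carried classes span `a•W' + Z'`. The lanes may then choose THEIR pencil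
through `X_t` (e.g. inside the Shimura variety with a global `K`-structure, through a pinned anchor) — the André column's «pencils of
our choice» inside road b02's `closes` chain; a finite étale base change `f ×_S S' → S'` of the given pencil (director-hodge R11.4's
«AddCover») serves every fibre through a preimage; the given pencil itself is the additive case. `k = 0` is allowed (then `W'` is
fibrewise algebraic-Lefschetz on `f'`: the Lefschetz fibres, datum-free). WHY THE OTHER BINDERS OF `closes` ACCEPT `f'`: Raynaud
(`raynaud1970_abelianScheme_section_projective`, quasi-projectivity from a section) is NOT applied to `f'` — quasi-projectivity of `𝒳'`
is PART of the datum — but to the given pencils, exactly as in rev 22 (padding engine and row b02, `VHCAbelianSchemesRoadLocusEngine`);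
André #21/#22 act only in `HC_AV ⟺ AbelianSchemeVHC` (`Ring2.Deform.HC_AV_iff_abelianSchemeVHC_of_andre1996`), untouched.
* §1 `AdmissibleRepresentativesLefAtDegLocal 𝒪 n p`, `LefAtExceptionalRegimeAtLocal 𝒪 n p` (binders of the graded predicates VERBATIM,
  conclusion per fibre `t`); additive ⟹ local (`f' := f`); regime-local ⟹ graded-local (case split, datum-free Lefschetz case);
  monotonicity in the door.
* §2 the kernel per pencil: additive DATA on a pencil + the door ⟹ the spanned class is algebraic on every fibre
  (`map_fiberι_mem_algebraicClasses_of_addData`, the data form of `…_of_lefAtDegAdd`); local crux + door ⟹ `W` algebraic on every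
  fibre of `f` ⟹ node (U) at `(n, p)` (`locusNotCountableAtDeg_of_lefAtDegLocal`).
* §3 heads through the engine of `VHCAbelianSchemesRoadLocusEngine.lean`: `hc_av_of_exceptionalRegimeAtLocal_diagonal_two` (door-generic),
  `hc_av_of_exceptionalRegimeAtLocal_twisted_diagonal_two` (EVERY `Adm`, door `TwistedPerfectDoorVHC C Adm` VERBATIM),
  `hc_av_of_exceptionalRegimeAtLocal_admTw'_diagonal_two` (EXACTLY the binder shape of the glue of record with `hDiag ↦ hDiagLoc`),
  the `(6,3)`-on twins granted `HCUpToDim 5`; additive slice ⟹ local slice.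

NOT claimed: any cell; that any pencil of our choice exists through a given fibre; anything about `HC_CM`.
References: [BuchweitzFlenner2003] §5 Thm. 5.1; [Bloch1972Semiregularity] Rem. (7.5); [vanGeemen1994HodgeAV] §2.4, Thm. 4.11;
[CharlesSchnell2014Notes] Prop. 11.3.11; [GrothendieckTopology1969] §1; [Andre1996Motifs] §6.3; [Markman2025SecantWeil] Thm. 1.4.1,
Thm. 1.5.1; [Markman2025SurveySecant] Cor. 1.3; [GortzWedhorn2023] Thm. 27.291; [Deligne1971HodgeII] 4.1.1.
-/

noncomputable section

open CategoryTheory CategoryTheory.Limits AlgebraicGeometry Topology MonoidalCategory CartesianMonoidalCategory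

namespace Summit.HodgeConjecture.HodgeConjecture.Ring2.SemiregularRepresentatives

set_option linter.dupNamespace false -- the cell's namespace repeats the summit name, as in every `Ring2*` file

open Literature.AlgebraicGeometry Literature.AlgebraicGeometry.Motives Literature.AlgebraicGeometry.HodgeTheory
open Literature.AlgebraicTopology.SingularHomology
open Literature.AlgebraicGeometry.Andre1996 (andre1996_cmAnchoredPencil
  andre1996_cmHodgeClasses_algebraicallyAnchoredPencils)
open Literature.Barriers.HodgeConjecture (divisorClassesSpan)
open Summit.Ventures.HSemireg (ObjClass LocalVariationalHodgeFor)
open Summit.HodgeConjecture.HodgeConjecture.Ring2.Hypotheses (AbelianSchemeVHC)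
open Summit.HodgeConjecture.HodgeConjecture.Ring2.Binders
open Summit.HodgeConjecture.HodgeConjecture.Ring2.ClassTargets

/-! ## §1 The local-in-the-fibre predicates -/

/-- **K-SR♭∃ for the door `𝒪` at `(n, p)`, LOCAL-IN-THE-FIBRE (SPAN) FORM** (`AdmissibleRepresentativesLefAtDegLocal 𝒪 n p`): the
binders of `AdmissibleRepresentativesLefAtDeg 𝒪 n p` VERBATIM; conclusion FOR EVERY FIBRE `t`: there are a pencil `f' : 𝒳' ⟶ S'`
(smooth projective family of relative dimension `n`, quasi-projective total space, over a smooth irreducible affine curve), a fibre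
`X'_{t'} ≅ X_t` (`e`), a global class `W'` on `𝒳'` with `e^*(W|_{X_t}) = W'|_{X'_{t'}}`, and finitely many (`k ≥ 0`) `𝒪`-admissible data
on `f'` — each at its own fibre `s i` of `f'`, with its own pinned degrees `I i ∋ p`, classes `κ i` and global fibrewise-Hodge extensions
`V i` — with `a ≠ 0`, `Z'` fibrewise algebraic-Lefschetz on `f'` and `a•W' + Z' = ∑ i, c i • V i p`. `f' := f` is the additive form
(`admissibleRepresentativesLefAtDegLocal_of_add`). OPEN in the middle range; a HYPOTHESIS wherever used.
[cite: vanGeemen1994HodgeAV, §2.4 and Thm. 4.11] [cite: BuchweitzFlenner2003, §5 Thm. 5.1] [cite: Markman2025SecantWeil, Thm. 1.4.1 and Thm. 1.5.1] -/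
@[conjecture] def AdmissibleRepresentativesLefAtDegLocal (𝒪 : ObjClass) (n p : ℕ) : Prop :=
  ∀ ⦃𝒳 S : SchemeOver ℂ⦄ (f : 𝒳 ⟶ S), IsSmoothProjectiveFamily f n → IsQuasiProjectiveOver 𝒳 →
    IrreducibleSpace S.left → IsAffine S.left → AlgebraicGeometry.Smooth S.hom → topologicalKrullDim S.left = 1 →
    (∀ s : ComplexPoints S, ∃ A' : AbelianVariety ℂ, A'.dim = n ∧ Nonempty (A'.X ≅ fiberOver f s)) →
    (∃ e : S ⟶ 𝒳, e ≫ f = 𝟙 S) →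
    ∀ (W : complexBetti 𝒳 (2 * p)),
      (∀ s : ComplexPoints S, IsRationalClass (complexBetti.map (fiberι f s) (2 * p) W) ∧
        IsOfHodgeType n (fiberOver f s) (2 * p) p p (complexBetti.map (fiberι f s) (2 * p) W)) →
      ∀ s₀ : ComplexPoints S,
        complexBetti.map (fiberι f s₀) (2 * p) W ∈ algebraicClasses (fiberOver f s₀) p →
        ∀ t : ComplexPoints S,
        ∃ (𝒳' S' : SchemeOver ℂ) (f' : 𝒳' ⟶ S') (t' : ComplexPoints S') (e : fiberOver f' t' ≅ fiberOver f t)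
          (W' : complexBetti 𝒳' (2 * p))
          (k : ℕ) (s : Fin k → ComplexPoints S') (I : Fin k → Finset ℕ)
          (κ : (i : Fin k) → (q : ℕ) → complexBetti (fiberOver f' (s i)) (2 * q))
          (V : Fin k → (q : ℕ) → complexBetti 𝒳' (2 * q)) (c : Fin k → ℂ) (a : ℂ) (Z : complexBetti 𝒳' (2 * p)),
          IsSmoothProjectiveFamily f' n ∧ IsQuasiProjectiveOver 𝒳' ∧ IrreducibleSpace S'.left ∧ IsAffine S'.left ∧
          AlgebraicGeometry.Smooth S'.hom ∧ topologicalKrullDim S'.left = 1 ∧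
          complexBetti.map e.hom (2 * p) (complexBetti.map (fiberι f t) (2 * p) W) =
            complexBetti.map (fiberι f' t') (2 * p) W' ∧
          (∀ i, p ∈ I i ∧ 𝒪 n (fiberOver f' (s i)) (I i) (κ i) ∧
            (∀ q ∈ I i, κ i q = complexBetti.map (fiberι f' (s i)) (2 * q) (V i q)) ∧
            (∀ q ∈ I i, ∀ u : ComplexPoints S',
              IsOfHodgeType n (fiberOver f' u) (2 * q) q q (complexBetti.map (fiberι f' u) (2 * q) (V i q)))) ∧
          a ≠ 0 ∧
          (∀ u : ComplexPoints S',
            complexBetti.map (fiberι f' u) (2 * p) Z ∈ algebraicClasses (fiberOver f' u) p ∧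
            complexBetti.map (fiberι f' u) (2 * p) Z ∈ divisorClassesSpan (fiberOver f' u) n p) ∧
          a • W' + Z = ∑ i, c i • V i p

/-- **Regime 2 of K-SR♭∃ for the door `𝒪` at `(n, p)`, LOCAL-IN-THE-FIBRE (SPAN) FORM** (`LefAtExceptionalRegimeAtLocal 𝒪 n p`): the
binders of `LefAtExceptionalRegimeAt 𝒪 n p` VERBATIM (the class `W` is NOT algebraic-Lefschetz on every fibre), the per-fibre conclusion
of `AdmissibleRepresentativesLefAtDegLocal` (`k = 0` allowed at a fibre: there the class is served Lefschetz-wise on the chosen pencil).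
OPEN in the middle range; a HYPOTHESIS wherever used. [cite: vanGeemen1994HodgeAV, §2.4 and Thm. 4.11]
[cite: BuchweitzFlenner2003, §5 Thm. 5.1] [cite: Markman2025SecantWeil, Thm. 1.4.1 and Thm. 1.5.1] -/
@[conjecture] def LefAtExceptionalRegimeAtLocal (𝒪 : ObjClass) (n p : ℕ) : Prop :=
  ∀ ⦃𝒳 S : SchemeOver ℂ⦄ (f : 𝒳 ⟶ S), IsSmoothProjectiveFamily f n → IsQuasiProjectiveOver 𝒳 →
    IrreducibleSpace S.left → IsAffine S.left → AlgebraicGeometry.Smooth S.hom → topologicalKrullDim S.left = 1 →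
    (∀ s : ComplexPoints S, ∃ A' : AbelianVariety ℂ, A'.dim = n ∧ Nonempty (A'.X ≅ fiberOver f s)) →
    (∃ e : S ⟶ 𝒳, e ≫ f = 𝟙 S) →
    ∀ (W : complexBetti 𝒳 (2 * p)),
      (∀ s : ComplexPoints S, IsRationalClass (complexBetti.map (fiberι f s) (2 * p) W) ∧
        IsOfHodgeType n (fiberOver f s) (2 * p) p p (complexBetti.map (fiberι f s) (2 * p) W)) →
      ∀ s₀ : ComplexPoints S,
        complexBetti.map (fiberι f s₀) (2 * p) W ∈ algebraicClasses (fiberOver f s₀) p →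
        (¬ ∀ s : ComplexPoints S,
          complexBetti.map (fiberι f s) (2 * p) W ∈ algebraicClasses (fiberOver f s) p ∧
          complexBetti.map (fiberι f s) (2 * p) W ∈ divisorClassesSpan (fiberOver f s) n p) →
        ∀ t : ComplexPoints S,
        ∃ (𝒳' S' : SchemeOver ℂ) (f' : 𝒳' ⟶ S') (t' : ComplexPoints S') (e : fiberOver f' t' ≅ fiberOver f t)
          (W' : complexBetti 𝒳' (2 * p))
          (k : ℕ) (s : Fin k → ComplexPoints S') (I : Fin k → Finset ℕ)
          (κ : (i : Fin k) → (q : ℕ) → complexBetti (fiberOver f' (s i)) (2 * q))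
          (V : Fin k → (q : ℕ) → complexBetti 𝒳' (2 * q)) (c : Fin k → ℂ) (a : ℂ) (Z : complexBetti 𝒳' (2 * p)),
          IsSmoothProjectiveFamily f' n ∧ IsQuasiProjectiveOver 𝒳' ∧ IrreducibleSpace S'.left ∧ IsAffine S'.left ∧
          AlgebraicGeometry.Smooth S'.hom ∧ topologicalKrullDim S'.left = 1 ∧
          complexBetti.map e.hom (2 * p) (complexBetti.map (fiberι f t) (2 * p) W) =
            complexBetti.map (fiberι f' t') (2 * p) W' ∧
          (∀ i, p ∈ I i ∧ 𝒪 n (fiberOver f' (s i)) (I i) (κ i) ∧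
            (∀ q ∈ I i, κ i q = complexBetti.map (fiberι f' (s i)) (2 * q) (V i q)) ∧
            (∀ q ∈ I i, ∀ u : ComplexPoints S',
              IsOfHodgeType n (fiberOver f' u) (2 * q) q q (complexBetti.map (fiberι f' u) (2 * q) (V i q)))) ∧
          a ≠ 0 ∧
          (∀ u : ComplexPoints S',
            complexBetti.map (fiberι f' u) (2 * p) Z ∈ algebraicClasses (fiberOver f' u) p ∧
            complexBetti.map (fiberι f' u) (2 * p) Z ∈ divisorClassesSpan (fiberOver f' u) n p) ∧
          a • W' + Z = ∑ i, c i • V i p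

variable {𝒪 𝒪' : ObjClass} {n p : ℕ}

/-- Functoriality bookkeeping (`(Iso.refl X).hom^* = id`). [folklore] -/
private theorem map_refl_hom (X : SchemeOver ℂ) (k : ℕ) (c : complexBetti X k) :
    complexBetti.map (Iso.refl X).hom k c = c := by
  rw [Iso.refl_hom, complexBetti.map_id]
  rfl

/-- **Additive ⟹ local (the graded crux)**: serve every fibre on the given pencil itself (`f' := f`, `t' := t`, `e := Iso.refl`,
`W' := W`). So the local form is WEAKER than the additive form. [folklore] -/
theorem admissibleRepresentativesLefAtDegLocal_of_add (h : AdmissibleRepresentativesLefAtDegAdd 𝒪 n p) :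
    AdmissibleRepresentativesLefAtDegLocal 𝒪 n p := by
  intro 𝒳 S f hf h𝒳 hirr haff hsm hdim habel he W hW s₀ hs₀ t
  obtain ⟨k, s, I, κ, V, c, a, Z, hdat, ha, hZ, hsum⟩ := h f hf h𝒳 hirr haff hsm hdim habel he W hW s₀ hs₀
  exact ⟨𝒳, S, f, t, Iso.refl _, W, k, s, I, κ, V, c, a, Z, hf, h𝒳, hirr, haff, hsm, hdim, map_refl_hom _ _ _,
    hdat, ha, hZ, hsum⟩

/-- **Additive ⟹ local (regime 2)**. [folklore] -/
theorem lefAtExceptionalRegimeAtLocal_of_add (h : LefAtExceptionalRegimeAtAdd 𝒪 n p) :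
    LefAtExceptionalRegimeAtLocal 𝒪 n p := by
  intro 𝒳 S f hf h𝒳 hirr haff hsm hdim habel he W hW s₀ hs₀ hexc t
  obtain ⟨k, s, I, κ, V, c, a, Z, -, hdat, ha, hZ, hsum⟩ := h f hf h𝒳 hirr haff hsm hdim habel he W hW s₀ hs₀ hexc
  exact ⟨𝒳, S, f, t, Iso.refl _, W, k, s, I, κ, V, c, a, Z, hf, h𝒳, hirr, haff, hsm, hdim, map_refl_hom _ _ _,
    hdat, ha, hZ, hsum⟩

/-- **Single ⟹ local (regime 2)**: the slice of record implies the local slice (through the additive one). [folklore] -/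
theorem lefAtExceptionalRegimeAtLocal_of_lefAtExceptionalRegimeAt (h : LefAtExceptionalRegimeAt 𝒪 n p) :
    LefAtExceptionalRegimeAtLocal 𝒪 n p :=
  lefAtExceptionalRegimeAtLocal_of_add (lefAtExceptionalRegimeAtAdd_of_lefAtExceptionalRegimeAt h)

/-- **The local graded crux from local regime 2 ALONE** — classical case split on «`W` algebraic-Lefschetz on every fibre of `f`»: if so,
every fibre is served on `f` itself by the EMPTY family (`a := 1`, `Z := −W`); if not, local regime 2. [cite: vanGeemen1994HodgeAV, §2.4] -/
theorem admissibleRepresentativesLefAtDegLocal_of_regimeLocal (h₂ : LefAtExceptionalRegimeAtLocal 𝒪 n p) :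
    AdmissibleRepresentativesLefAtDegLocal 𝒪 n p := by
  intro 𝒳 S f hf h𝒳 hirr haff hsm hdim habel he W hW s₀ hs₀ t
  by_cases hL : ∀ s : ComplexPoints S,
      complexBetti.map (fiberι f s) (2 * p) W ∈ algebraicClasses (fiberOver f s) p ∧
      complexBetti.map (fiberι f s) (2 * p) W ∈ divisorClassesSpan (fiberOver f s) n p
  · refine ⟨𝒳, S, f, t, Iso.refl _, W, 0, Fin.elim0, Fin.elim0, fun i => i.elim0, Fin.elim0, Fin.elim0, 1, -W,
      hf, h𝒳, hirr, haff, hsm, hdim, map_refl_hom _ _ _, fun i => i.elim0, one_ne_zero, fun u => ⟨?_, ?_⟩, ?_⟩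
    · rw [map_neg]; exact Submodule.neg_mem _ (hL u).1
    · rw [map_neg]; exact Submodule.neg_mem _ (hL u).2
    · rw [one_smul, add_neg_cancel, Fin.sum_univ_zero]
  · exact h₂ f hf h𝒳 hirr haff hsm hdim habel he W hW s₀ hs₀ hL t

/-- The local graded crux at `(n, p)` is monotone in the door. [folklore] -/
theorem AdmissibleRepresentativesLefAtDegLocal.mono (h𝒪 : ∀ n X₀ I κ, 𝒪 n X₀ I κ → 𝒪' n X₀ I κ)
    (h : AdmissibleRepresentativesLefAtDegLocal 𝒪 n p) : AdmissibleRepresentativesLefAtDegLocal 𝒪' n p := by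
  intro 𝒳 S f hf h𝒳 hirr haff hsm hdim habel he W hW s₀ hs₀ t
  obtain ⟨𝒳', S', f', t', e, W', k, s, I, κ, V, c, a, Z, hf', h𝒳', hirr', haff', hsm', hdim', hWe, hdat, ha, hZ, hsum⟩ :=
    h f hf h𝒳 hirr haff hsm hdim habel he W hW s₀ hs₀ t
  exact ⟨𝒳', S', f', t', e, W', k, s, I, κ, V, c, a, Z, hf', h𝒳', hirr', haff', hsm', hdim', hWe,
    fun i => ⟨(hdat i).1, h𝒪 _ _ _ _ (hdat i).2.1, (hdat i).2.2.1, (hdat i).2.2.2⟩, ha, hZ, hsum⟩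

/-- Local regime 2 at `(n, p)` is monotone in the door. [folklore] -/
theorem LefAtExceptionalRegimeAtLocal.mono (h𝒪 : ∀ n X₀ I κ, 𝒪 n X₀ I κ → 𝒪' n X₀ I κ)
    (h : LefAtExceptionalRegimeAtLocal 𝒪 n p) : LefAtExceptionalRegimeAtLocal 𝒪' n p := by
  intro 𝒳 S f hf h𝒳 hirr haff hsm hdim habel he W hW s₀ hs₀ hexc t
  obtain ⟨𝒳', S', f', t', e, W', k, s, I, κ, V, c, a, Z, hf', h𝒳', hirr', haff', hsm', hdim', hWe, hdat, ha, hZ, hsum⟩ :=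
    h f hf h𝒳 hirr haff hsm hdim habel he W hW s₀ hs₀ hexc t
  exact ⟨𝒳', S', f', t', e, W', k, s, I, κ, V, c, a, Z, hf', h𝒳', hirr', haff', hsm', hdim', hWe,
    fun i => ⟨(hdat i).1, h𝒪 _ _ _ _ (hdat i).2.1, (hdat i).2.2.1, (hdat i).2.2.2⟩, ha, hZ, hsum⟩

/-! ## §2 The kernel per pencil: additive DATA on any pencil + the door ⟹ the spanned class is algebraic on every fibre -/

variable {𝒳 S : SchemeOver ℂ}

/-- **Additive DATA on a pencil + the door ⟹ the spanned class is algebraic on EVERY fibre** — the data form of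
`map_fiberι_mem_algebraicClasses_of_lefAtDegAdd` (same proof: the door per datum via `not_countable_algebraicityLocus_of_datum`, the curve
residual `curve_not_subset_iUnion_of_not_countable` + `Theorems.mem_algebraicClasses_of_thickSet`, then `Submodule.sum_mem`). The pencil
needs NO abelian-fibre or section clause. [cite: BuchweitzFlenner2003, §5 Thm. 5.1 (argument shape)]
[cite: CharlesSchnell2014Notes, Prop. 11.3.11 (proof)] -/
theorem map_fiberι_mem_algebraicClasses_of_addData (hT : LocalVariationalHodgeFor 𝒪) (f : 𝒳 ⟶ S)
    (hf : IsSmoothProjectiveFamily f n) (h𝒳 : IsQuasiProjectiveOver 𝒳) [IrreducibleSpace S.left] [IsAffine S.left]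
    [AlgebraicGeometry.Smooth S.hom] (hdim : topologicalKrullDim S.left = 1) (W : complexBetti 𝒳 (2 * p))
    {k : ℕ} {s : Fin k → ComplexPoints S} {I : Fin k → Finset ℕ}
    {κ : (i : Fin k) → (q : ℕ) → complexBetti (fiberOver f (s i)) (2 * q)} {V : Fin k → (q : ℕ) → complexBetti 𝒳 (2 * q)}
    {c : Fin k → ℂ} {a : ℂ} {Z : complexBetti 𝒳 (2 * p)}
    (hdat : ∀ i, p ∈ I i ∧ 𝒪 n (fiberOver f (s i)) (I i) (κ i) ∧
      (∀ q ∈ I i, κ i q = complexBetti.map (fiberι f (s i)) (2 * q) (V i q)) ∧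
      (∀ q ∈ I i, ∀ u : ComplexPoints S,
        IsOfHodgeType n (fiberOver f u) (2 * q) q q (complexBetti.map (fiberι f u) (2 * q) (V i q))))
    (ha : a ≠ 0) (hZ : ∀ u : ComplexPoints S, complexBetti.map (fiberι f u) (2 * p) Z ∈ algebraicClasses (fiberOver f u) p)
    (hsum : a • W + Z = ∑ i, c i • V i p) (t : ComplexPoints S) :
    complexBetti.map (fiberι f t) (2 * p) W ∈ algebraicClasses (fiberOver f t) p := by
  have hV : ∀ (i : Fin k) (u : ComplexPoints S),
      complexBetti.map (fiberι f u) (2 * p) (V i p) ∈ algebraicClasses (fiberOver f u) p := by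
    intro i
    obtain ⟨hpI, hκ, hκV, hVH⟩ := hdat i
    have hnc : ¬ {u : ComplexPoints S | complexBetti.map (fiberι f u) (2 * p) (V i p) ∈
        algebraicClasses (fiberOver f u) p}.Countable :=
      not_countable_algebraicityLocus_of_datum hT f hf hdim (V i p)
        ⟨s i, I i, κ i, V i, 1, 0, hpI, hκ, one_ne_zero,
          fun u => by rw [map_zero]; exact Submodule.zero_mem _,
          by rw [one_smul, add_zero], hκV, hVH⟩
    exact Theorems.mem_algebraicClasses_of_thickSet charlesSchnell_algebraicityLocus_iUnion_closed_holds f hf h𝒳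
      (IsQuasiProjectiveOver.of_isAffine S) ‹_› (V i p) _
      (curve_not_subset_iUnion_of_not_countable hdim _ hnc) (fun u hu => hu)
  have hWt : complexBetti.map (fiberι f t) (2 * p) W =
      a⁻¹ • (complexBetti.map (fiberι f t) (2 * p) (∑ i, c i • V i p) -
        complexBetti.map (fiberι f t) (2 * p) Z) := by
    rw [← hsum, map_add, map_smul, add_sub_cancel_right, smul_smul, inv_mul_cancel₀ ha, one_smul]
  rw [hWt, map_sum]
  refine Submodule.smul_mem _ _ (Submodule.sub_mem _ (Submodule.sum_mem _ fun i _ => ?_) (hZ t))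
  rw [map_smul]
  exact Submodule.smul_mem _ _ (hV i t)

/-- **Per pencil, the LOCAL graded crux + the door ⟹ `W` is algebraic on EVERY fibre**: at the fibre `t`, run
`map_fiberι_mem_algebraicClasses_of_addData` on the chosen pencil `f'` and transport along `X'_{t'} ≅ X_t`
(`mem_algebraicClasses_map_iff_of_iso`). [cite: BuchweitzFlenner2003, §5 Thm. 5.1] [cite: GrothendieckTopology1969, §1] -/
theorem map_fiberι_mem_algebraicClasses_of_lefAtDegLocal (hT : LocalVariationalHodgeFor 𝒪)
    (hSR : AdmissibleRepresentativesLefAtDegLocal 𝒪 n p) (f : 𝒳 ⟶ S) (hf : IsSmoothProjectiveFamily f n)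
    (h𝒳 : IsQuasiProjectiveOver 𝒳) [IrreducibleSpace S.left] [IsAffine S.left] [AlgebraicGeometry.Smooth S.hom]
    (hdim : topologicalKrullDim S.left = 1)
    (habel : ∀ s : ComplexPoints S, ∃ A' : AbelianVariety ℂ, A'.dim = n ∧ Nonempty (A'.X ≅ fiberOver f s))
    (he : ∃ e : S ⟶ 𝒳, e ≫ f = 𝟙 S) (W : complexBetti 𝒳 (2 * p))
    (hW : ∀ s : ComplexPoints S, IsRationalClass (complexBetti.map (fiberι f s) (2 * p) W) ∧
      IsOfHodgeType n (fiberOver f s) (2 * p) p p (complexBetti.map (fiberι f s) (2 * p) W))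
    {s₀ : ComplexPoints S} (hs₀ : complexBetti.map (fiberι f s₀) (2 * p) W ∈ algebraicClasses (fiberOver f s₀) p)
    (t : ComplexPoints S) :
    complexBetti.map (fiberι f t) (2 * p) W ∈ algebraicClasses (fiberOver f t) p := by
  obtain ⟨𝒳', S', f', t', e, W', k, s, I, κ, V, c, a, Z, hf', h𝒳', hirr', haff', hsm', hdim', hWe, hdat, ha, hZ, hsum⟩ :=
    hSR f hf h𝒳 ‹_› ‹_› ‹_› hdim habel he W hW s₀ hs₀ t
  haveI := hirr'
  haveI := haff'
  haveI := hsm'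
  have h' := map_fiberι_mem_algebraicClasses_of_addData hT f' hf' h𝒳' hdim' W' hdat ha (fun u => (hZ u).1) hsum t'
  rw [← hWe] at h'
  exact (mem_algebraicClasses_map_iff_of_iso e).1 h'

/-- **Feeder (local data)**: the door + the LOCAL graded crux at `(n, p)` ⟹ node (U) at `(n, p)` (the locus is all of `S(ℂ)`).
[cite: BuchweitzFlenner2003, §5 Thm. 5.1] [cite: CharlesSchnell2014Notes, Prop. 11.3.11 (proof)] -/
theorem locusNotCountableAtDeg_of_lefAtDegLocal (hT : LocalVariationalHodgeFor 𝒪)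
    (hSR : AdmissibleRepresentativesLefAtDegLocal 𝒪 n p) : LocusNotCountableAtDeg n p := by
  intro 𝒳 S f hf h𝒳 hirr haff hsm hdim habel he W hW s₀ hs₀
  haveI := hirr
  haveI := haff
  haveI := hsm
  have huniv : {s : ComplexPoints S |
      complexBetti.map (fiberι f s) (2 * p) W ∈ algebraicClasses (fiberOver f s) p} = Set.univ :=
    Set.eq_univ_of_forall fun t =>
      map_fiberι_mem_algebraicClasses_of_lefAtDegLocal hT hSR f hf h𝒳 hdim habel he W hW hs₀ t
  rw [huniv]
  exact not_countable_of_isOpen_of_curve hdim isOpen_univ ⟨s₀, Set.mem_univ _⟩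

/-- **Feeder (local regime 2)**: the door + LOCAL regime 2 at `(n, p)` ⟹ node (U) at `(n, p)` (regime 1 datum-free).
[cite: vanGeemen1994HodgeAV, §2.4] [cite: BuchweitzFlenner2003, §5 Thm. 5.1] -/
theorem locusNotCountableAtDeg_of_exceptionalRegimeAtLocal (hT : LocalVariationalHodgeFor 𝒪)
    (h₂ : LefAtExceptionalRegimeAtLocal 𝒪 n p) : LocusNotCountableAtDeg n p :=
  locusNotCountableAtDeg_of_lefAtDegLocal hT (admissibleRepresentativesLefAtDegLocal_of_regimeLocal h₂)

/-! ## §3 The kernel heads (door-generic; the twisted door for every admissibility notion; the road's `AdmTw'`) -/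

/-- **`HC_AV` from the door and LOCAL regime 2 on the diagonal `m ≥ 2` — door-generic.**
[cite: Andre1996Motifs, §6.3 Lemmes 6.3.1–6.3.3] [cite: vanGeemen1994HodgeAV, §2.4] [cite: GortzWedhorn2023, Thm. 27.291] -/
theorem hc_av_of_exceptionalRegimeAtLocal_diagonal_two (hT : LocalVariationalHodgeFor 𝒪)
    (hDiag : ∀ m : ℕ, 2 ≤ m → LefAtExceptionalRegimeAtLocal 𝒪 (2 * m) m)
    (hqp : OneParameterAbelianSchemeQuasiProjective) (h₂₁ : andre1996_cmAnchoredPencil)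
    (h₂₂ : andre1996_cmHodgeClasses_algebraicallyAnchoredPencils) :
    Theses.PadicSemiregularLift.HodgeAbelianVarieties :=
  hc_av_of_locus_diagonal_two (fun m hm => locusNotCountableAtDeg_of_exceptionalRegimeAtLocal hT (hDiag m hm)) hqp h₂₁ h₂₂

/-- **`HC_AV` from the door, `HCUpToDim 5` and LOCAL regime 2 on the diagonal `m ≥ 3` — door-generic.**
[cite: Andre1996Motifs, §6.3 Lemmes 6.3.1–6.3.3] [cite: Markman2025SurveySecant, Cor. 1.3] [cite: GortzWedhorn2023, Thm. 27.291] -/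
theorem hc_av_of_hcUpToDim_five_of_exceptionalRegimeAtLocal_diagonal_three (hT : LocalVariationalHodgeFor 𝒪) (h₅ : HCUpToDim 5)
    (hDiag : ∀ m : ℕ, 3 ≤ m → LefAtExceptionalRegimeAtLocal 𝒪 (2 * m) m)
    (hqp : OneParameterAbelianSchemeQuasiProjective) (h₂₁ : andre1996_cmAnchoredPencil)
    (h₂₂ : andre1996_cmHodgeClasses_algebraicallyAnchoredPencils) :
    Theses.PadicSemiregularLift.HodgeAbelianVarieties :=
  hc_av_of_hcUpToDim_five_of_locus_diagonal_three h₅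
    (fun m hm => locusNotCountableAtDeg_of_exceptionalRegimeAtLocal hT (hDiag m hm)) hqp h₂₁ h₂₂

/-- **`HC_AV` in the `closes`-shape of road b02 with the crux replaced by the LOCAL diagonal slice
`∀ C m, 2 ≤ m → LefAtExceptionalRegimeAtLocal (twisted door at Adm) (2m) m`, for EVERY admissibility notion `Adm`** — K-C, the door
`TwistedPerfectDoorVHC C Adm` VERBATIM, Raynaud, André #21/#22; no inclusion hypothesis, no class target, no `HC_CM`.
[cite: Andre1996Motifs, §6.3 Lemmes 6.3.1–6.3.3] [cite: BrosnanFangNiePearlstein2009, §6 Lemma 48]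
[cite: Pridham2024Semiregularity, Rem. 2.26 with Cor. 2.25] [cite: GortzWedhorn2023, Thm. 27.291] -/
theorem hc_av_of_exceptionalRegimeAtLocal_twisted_diagonal_two (hC : ChernCharacterOnBetti) {Adm : PerfectAdmissibility}
    (hDiag : ∀ (C : ChernCharacterBetti) (m : ℕ), 2 ≤ m →
      LefAtExceptionalRegimeAtLocal (twistedReflexiveClass C Adm) (2 * m) m)
    (hDoor : ∀ C : ChernCharacterBetti, TwistedPerfectDoorVHC C Adm)
    (hR : raynaud1970_abelianScheme_section_projective) (h₂₁ : andre1996_cmAnchoredPencil)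
    (h₂₂ : andre1996_cmHodgeClasses_algebraicallyAnchoredPencils) :
    Theses.PadicSemiregularLift.HodgeAbelianVarieties := by
  obtain ⟨C⟩ := hC
  exact hc_av_of_exceptionalRegimeAtLocal_diagonal_two (𝒪 := twistedReflexiveClass C Adm) (hDoor C) (hDiag C)
    (oneParameterAbelianSchemeQuasiProjective_of_raynaud1970 hR) h₂₁ h₂₂

/-- **The same from `(6, 3)` on, granted `HCUpToDim 5`** (Markman 2025 Cor. 1.3, UNREFEREED), every `Adm`.
[cite: Andre1996Motifs, §6.3 Lemmes 6.3.1–6.3.3] [cite: Markman2025SurveySecant, Cor. 1.3] [cite: GortzWedhorn2023, Thm. 27.291] -/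
theorem hc_av_of_hcUpToDim_five_of_exceptionalRegimeAtLocal_twisted_diagonal_three (hC : ChernCharacterOnBetti)
    {Adm : PerfectAdmissibility} (h₅ : HCUpToDim 5)
    (hDiag : ∀ (C : ChernCharacterBetti) (m : ℕ), 3 ≤ m →
      LefAtExceptionalRegimeAtLocal (twistedReflexiveClass C Adm) (2 * m) m)
    (hDoor : ∀ C : ChernCharacterBetti, TwistedPerfectDoorVHC C Adm)
    (hR : raynaud1970_abelianScheme_section_projective) (h₂₁ : andre1996_cmAnchoredPencil)
    (h₂₂ : andre1996_cmHodgeClasses_algebraicallyAnchoredPencils) :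
    Theses.PadicSemiregularLift.HodgeAbelianVarieties := by
  obtain ⟨C⟩ := hC
  exact hc_av_of_hcUpToDim_five_of_exceptionalRegimeAtLocal_diagonal_three (𝒪 := twistedReflexiveClass C Adm) (hDoor C) h₅
    (hDiag C) (oneParameterAbelianSchemeQuasiProjective_of_raynaud1970 hR) h₂₁ h₂₂

/-- **`HC_AV` in the `closes`-shape at the road's PRIMED twisted door `AdmTw' := gluableSigmaAdmissible ∨ bfSingleAdmissible'`, crux =
the LOCAL diagonal slice** — EXACTLY the binder shape of the glue of record `hc_av_of_exceptionalRegimeAt_admTw'_diagonal_two`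
(`hC hDiag hDoor hR h₂₁ h₂₂`) with `hDiag ↦ hDiagLoc`, `hDoor` the body of item 20706 `TwistedPerfectDoorPrime` VERBATIM.
[cite: Andre1996Motifs, §6.3 Lemmes 6.3.1–6.3.3] [cite: BuchweitzFlenner2003, §5 Thm. 5.1] [cite: Pridham2024Semiregularity, Rem. 2.26 with Cor. 2.25]
[cite: Markman2025SecantWeil, Thm. 1.4.1 and Thm. 1.5.1] -/
theorem hc_av_of_exceptionalRegimeAtLocal_admTw'_diagonal_two (hC : ChernCharacterOnBetti)
    (hDiagLoc : ∀ (C : ChernCharacterBetti) (m : ℕ), 2 ≤ m →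
      LefAtExceptionalRegimeAtLocal (twistedReflexiveClass C
        (fun n X₀ I E => Summit.Ventures.HSemireg.gluableSigmaAdmissible n X₀ I E ∨ bfSingleAdmissible' n X₀ I E)) (2 * m) m)
    (hDoor : ∀ C : ChernCharacterBetti, TwistedPerfectDoorVHC C
      (fun n X₀ I E => Summit.Ventures.HSemireg.gluableSigmaAdmissible n X₀ I E ∨ bfSingleAdmissible' n X₀ I E))
    (hR : raynaud1970_abelianScheme_section_projective) (h₂₁ : andre1996_cmAnchoredPencil)
    (h₂₂ : andre1996_cmHodgeClasses_algebraicallyAnchoredPencils) :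
    Theses.PadicSemiregularLift.HodgeAbelianVarieties :=
  hc_av_of_exceptionalRegimeAtLocal_twisted_diagonal_two hC hDiagLoc hDoor hR h₂₁ h₂₂

/-- **The same at `AdmTw'` from `(6, 3)` on, granted `HCUpToDim 5`.** [cite: Andre1996Motifs, §6.3 Lemmes 6.3.1–6.3.3]
[cite: Markman2025SurveySecant, Cor. 1.3] [cite: Markman2025SecantWeil, Thm. 1.5.1] -/
theorem hc_av_of_hcUpToDim_five_of_exceptionalRegimeAtLocal_admTw'_diagonal_three (hC : ChernCharacterOnBetti)
    (h₅ : HCUpToDim 5)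
    (hDiagLoc : ∀ (C : ChernCharacterBetti) (m : ℕ), 3 ≤ m →
      LefAtExceptionalRegimeAtLocal (twistedReflexiveClass C
        (fun n X₀ I E => Summit.Ventures.HSemireg.gluableSigmaAdmissible n X₀ I E ∨ bfSingleAdmissible' n X₀ I E)) (2 * m) m)
    (hDoor : ∀ C : ChernCharacterBetti, TwistedPerfectDoorVHC C
      (fun n X₀ I E => Summit.Ventures.HSemireg.gluableSigmaAdmissible n X₀ I E ∨ bfSingleAdmissible' n X₀ I E))
    (hR : raynaud1970_abelianScheme_section_projective) (h₂₁ : andre1996_cmAnchoredPencil)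
    (h₂₂ : andre1996_cmHodgeClasses_algebraicallyAnchoredPencils) :
    Theses.PadicSemiregularLift.HodgeAbelianVarieties :=
  hc_av_of_hcUpToDim_five_of_exceptionalRegimeAtLocal_twisted_diagonal_three hC h₅ hDiagLoc hDoor hR h₂₁ h₂₂

/-- **The ADDITIVE slice of rev 23 IMPLIES the local slice** (per `C` and `m`): `SemiregularSheafRepresentativesTwPrimeAtDiagAdd` would be the
STRONGER parent of a local re-key. [folklore] -/
theorem exceptionalRegimeAtLocal_admTw'_diagonal_of_exceptionalRegimeAtAdd
    (hDiagAdd : ∀ (C : ChernCharacterBetti) (m : ℕ), 2 ≤ m →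
      LefAtExceptionalRegimeAtAdd (twistedReflexiveClass C
        (fun n X₀ I E => Summit.Ventures.HSemireg.gluableSigmaAdmissible n X₀ I E ∨ bfSingleAdmissible' n X₀ I E)) (2 * m) m) :
    ∀ (C : ChernCharacterBetti) (m : ℕ), 2 ≤ m →
      LefAtExceptionalRegimeAtLocal (twistedReflexiveClass C
        (fun n X₀ I E => Summit.Ventures.HSemireg.gluableSigmaAdmissible n X₀ I E ∨ bfSingleAdmissible' n X₀ I E)) (2 * m) m :=
  fun C m hm => lefAtExceptionalRegimeAtLocal_of_add (hDiagAdd C m hm)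

end Summit.HodgeConjecture.HodgeConjecture.Ring2.SemiregularRepresentatives

end
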